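/-
Copyright (c) 2026 the pub-hodgecm-mathlib formalisation cell (harness21).  Prover seat hodgecm-mathlib-K2Liu-p09 (g0): Track B «K2-LIT»,
#184♮ = hLiu418 = stmt-HodgeConjecture-24832, file #9 of the K2_Liu road: SOCKET `sig_K2LiuSiegelEisensteinDoubledSummable` PAID BY NAME; 2026-09-04.
-/
import Summits.HodgeConjecture.HodgeConjecture.Theorems.K2LiuSiegelEisensteinDoubledSummableReduction
import Summits.HodgeConjecture.HodgeConjecture.Theorems.K2LiuIwasawaDatumNonempty
import Summits.HodgeConjecture.HodgeConjecture.Theorems.K2LiuSiegelDoubledCountReduction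
import Summits.HodgeConjecture.HodgeConjecture.Theorems.K2LiuSiegelDoubledParabolicReduction
import Summits.HodgeConjecture.HodgeConjecture.Theorems.K2LiuSiegelDeltaHeightExists        -- ★ p854993 (K2Liu-p07): continuous height
import Summits.HodgeConjecture.HodgeConjecture.Theorems.K2LiuGodementParabolicIntegral       -- ★ A2: Godement's lemma
import Summits.HodgeConjecture.HodgeConjecture.Theorems.K2LiuSiegelDoubledLeviChart           -- ★ B1b: the Siegel–Levi chart
import Summits.HodgeConjecture.HodgeConjecture.Theorems.K2LiuSiegelDoubledRationalPoints       -- ★ B1c: rational Levi / unipotent points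
import Summits.HodgeConjecture.HodgeConjecture.Theorems.K2LiuSiegelDoubledUnipotentChart      -- ★ B3a: the unipotent chart
import Summits.HodgeConjecture.HodgeConjecture.Theorems.K2LiuSiegelDoubledUnipotentCover      -- ★ B2: compact fundamental set of N_Δ
import Summits.HodgeConjecture.HodgeConjecture.Theorems.K2LiuSiegelDoubledUnipotentScaling    -- ★ B3b: centre scaling
import Mathlib.MeasureTheory.Measure.Haar.Basic
import HarnessLib

/-!
# Crux `HLiu418`, Track B road `K2_Liu`, unit U3a «SIEGEL EISENSTEIN SERIES», file #9:
# SOCKET `sig_K2LiuSiegelEisensteinDoubledSummable` — ABSOLUTE CONVERGENCE of the Siegel Eisenstein series of `U(n,n) = U(𝕎 ⊕ −𝕎)`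
# on `Re s > n/2` (Godement's criterion for the Siegel parabolic), PAID BY NAME

Cell `hodgecm-mathlib`, crux item hLiu418 = `stmt-HodgeConjecture-24832`; squad K2 ∕ K2Liu, prover K2Liu-p09 (g0).  THEOREMS ONLY; lane
`--supports stmt-HodgeConjecture-24832` (socket #9 of `Cruxes/HLiu418/Lines/K2_Liu_CurveThetaSigs_U3a_SiegelEisenstein.lean` :103, type VERBATIM).

ASSEMBLY.  `parabolicIntegral` (= the former stub E5′): for `τ > 2n` there are a Haar measure `μ_P` on `P_Δ(𝔸)` and a `P_Δ(L⁺)`-covering weight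
`w₁` with `∫⁻ 𝟙{|det_Δ|^{1/2} ≤ C₁} |det_Δ|^{τ/2} w₁ dμ_P < ∞` — by ★ GODEMENT'S LEMMA `godement_parabolic_integral` for `P_Δ(𝔸) = M_Δ ⋉ N_Δ`
(★ `exists_siegelLeviChart`) with Levi chart `φ : GL_n(𝔸_L) ≃ₜ* M_Δ` (rational on `GL_n(L)`, ★ `mem_ratH_of_blk_eq_levi_map`),
`χ = |det_Δ|^{1/2} = |det|^{1/2} ∘ φ⁻¹`, the compact `N_Δ(L⁺)`-fundamental set (★ `exists_compact_unipotent_cover`) and the centre scaling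
`c₀ = n² [L:ℚ]` of the Haar measure of `N_Δ` (★ `exists_haar_conjBy_scaling`): the convergence condition `c₀ < n [L:ℚ] · ½ · τ` IS `τ > 2n`.
Then **`siegelEisensteinDoubledSummable`** = ★ (I) Iwasawa compactness + ★ (II) reduction + ★ (III-a) Plücker height (continuous, ★ p854993) +
★ count reduction + ★ parabolic reduction + `parabolicIntegral` at `τ = 2 Re s + n > 2n ⟺ Re s > n/2`.
[Godement, Sém. Bourbaki 257 §8; Garrett (2018) §3.10 Cor. 3.10.2; Moeglin–Waldspurger II.1.5; Tan (1999) §1; Liu (2021) §B.3.]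

HONEST LABEL.  This file pays socket #9 of the U3a line; by itself it retires no named input: `HC_CM` is proved only modulo the 7 printed
citations (2 remaining named inputs: hLiu418 = `stmt-HodgeConjecture-24832`, h413 = `stmt-HodgeConjecture-24833`) until rung 0 closes.
-/

set_option autoImplicit false
-- the mandated namespace repeats the single-problem summit's segment (`HodgeConjecture.HodgeConjecture`)
set_option linter.dupNamespace false

noncomputable section

open scoped Matrix ENNReal NNReal
open NumberField IsDedekindDomain MeasureTheory Measure

namespace Summit.HodgeConjecture.HodgeConjecture.Cruxes.HLiu418.K2LiuSiegelEisensteinDoubledSummable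

open Literature.NumberTheory.GelbartRogawski1991.AdaptedBlocks
open Literature.NumberTheory.Automorphic Literature.NumberTheory.Automorphic.UnitaryGroup Literature.NumberTheory.GaloisRepresentations
open Literature.NumberTheory.GelbartRogawski1991 Literature.NumberTheory.GelbartRogawski1991.GRConstruction
open Literature.NumberTheory.K2Lit.SiegelDoubled
open Literature.MeasureTheory.Group
open UnitaryDualPair
open Summit.HodgeConjecture.HodgeConjecture.Cruxes.HLiu418.K2LiuSiegelEisensteinDoubledSummableReduction
open Summit.HodgeConjecture.HodgeConjecture.Cruxes.HLiu418.K2LiuIwasawaDatumNonempty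
open Summit.HodgeConjecture.HodgeConjecture.Cruxes.HLiu418.K2LiuSiegelDoubledHeightSmear
open Summit.HodgeConjecture.HodgeConjecture.Cruxes.HLiu418.K2LiuSiegelDoubledCountReduction
open Summit.HodgeConjecture.HodgeConjecture.Cruxes.HLiu418.K2LiuSiegelDoubledUnfold
open Summit.HodgeConjecture.HodgeConjecture.Cruxes.HLiu418.K2LiuSiegelDoubledParabolicReduction
open Summit.HodgeConjecture.HodgeConjecture.Cruxes.HLiu418.K2LiuSiegelDeltaHeightExists
open Summit.HodgeConjecture.HodgeConjecture.Cruxes.HLiu418.K2LiuGodementParabolicIntegral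
open Summit.HodgeConjecture.HodgeConjecture.Cruxes.HLiu418.K2LiuSiegelDoubledLeviMatrix
open Summit.HodgeConjecture.HodgeConjecture.Cruxes.HLiu418.K2LiuSiegelDoubledLeviChart
open Summit.HodgeConjecture.HodgeConjecture.Cruxes.HLiu418.K2LiuSiegelDoubledRationalPoints
open Summit.HodgeConjecture.HodgeConjecture.Cruxes.HLiu418.K2LiuSiegelDoubledUnipotentChart
open Summit.HodgeConjecture.HodgeConjecture.Cruxes.HLiu418.K2LiuSiegelDoubledUnipotentCover
open Summit.HodgeConjecture.HodgeConjecture.Cruxes.HLiu418.K2LiuSiegelDoubledUnipotentScaling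

variable (L : Type) [Field L] [NumberField L] [IsCMField L]
variable {N M n : ℕ} (e : Fin N × Fin M ≃ Fin n)
  (dV : Fin N → L) (hdV : ∀ i, IsCMField.complexConj L (dV i) = dV i)
  (dW : Fin M → L) (hdW : ∀ i, IsCMField.complexConj L (dW i) = dW i)

/-! ## §1 Glue: `|det_Δ|^{1/2}` on the Levi and on the unipotent radical -/

/-- `modDelta p = 1` when `det_Δ p = 1`. [cite: Tan1999, §1] -/
theorem modDelta_eq_one_of_detDelta_eq_one {p : HA L e dV hdV dW hdW} (h : detDelta L e dV hdV dW hdW p = 1) :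
    modDelta L e dV hdV dW hdW p = 1 := by
  have hu : IsUnit (detDelta L e dV hdV dW hdW p) := by rw [h]; exact isUnit_one
  have hunit : hu.unit = 1 := Units.ext (by rw [IsUnit.unit_spec, h, Units.val_one])
  rw [modDelta, dif_pos hu, hunit, ← coe_ideleNorm, map_one, NNReal.coe_one, Real.sqrt_one]

/-- **`|det_Δ u| = 1` on `N_Δ`**: `det_Δ u = det (blkA + blkC) = det 1`. [cite: HarrisKudlaSweet1996, §1 (1.12)] -/
theorem modDelta_eq_one_of_blkA_eq_one {u : HA L e dV hdV dW hdW} (hP : IsSiegelDelta L e dV hdV dW hdW u)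
    (hA : blkA (blk L e dV hdV dW hdW u) = 1) : modDelta L e dV hdV dW hdW u = 1 := by
  refine modDelta_eq_one_of_detDelta_eq_one L e dV hdV dW hdW ?_
  rw [detDelta, deltaBlock, ← blkA_add_blkC, hA, (blkC_eq_zero_iff _).2 hP, add_zero, Matrix.det_one]

/-- **`|det_Δ (φ g)|^{1/2} = |det g|_𝔸^{1/2}`** for an element with Levi matrix `m(g)`. [cite: HarrisKudlaSweet1996, §1 (1.11)] -/
theorem modDelta_of_blk_eq_levi {q : HA L e dV hdV dW hdW} {g : GL (Fin n) (AdeleRing (𝓞 L) L)} {D : Matrix (Fin n) (Fin n) (AdeleRing (𝓞 L) L)}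
    (hq : blk L e dV hdV dW hdW q =
      cayR (AdeleRing (𝓞 L) L) (Fin n) * Matrix.fromBlocks (g : Matrix (Fin n) (Fin n) (AdeleRing (𝓞 L) L)) 0 0 D * cayRinv (AdeleRing (𝓞 L) L) (Fin n)) :
    modDelta L e dV hdV dW hdW q = ((glAbsDet n L g : ℝ≥0) : ℝ) ^ (1 / 2 : ℝ) := by
  have hdet : detDelta L e dV hdV dW hdW q = ((Matrix.GeneralLinearGroup.det g : (AdeleRing (𝓞 L) L)ˣ) : AdeleRing (𝓞 L) L) := by
    rw [detDelta, deltaBlock_of_blk_eq_levi L e dV hdV dW hdW hq, Matrix.GeneralLinearGroup.val_det_apply]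
  have hu : IsUnit (detDelta L e dV hdV dW hdW q) := by rw [hdet]; exact Units.isUnit _
  have hunit : hu.unit = Matrix.GeneralLinearGroup.det g := Units.ext (by rw [IsUnit.unit_spec, hdet])
  rw [modDelta, dif_pos hu, hunit, Real.sqrt_eq_rpow]
  congr 1
  exact (coe_ideleNorm (K := L) _).symm

/-! ## §2 E5′: Godement's parabolic integral on `P_Δ(𝔸)` -/

/-- **E5′ — GODEMENT'S PARABOLIC INTEGRAL** (`dV, dW ≠ 0`): for `τ > 2n` there are a left Haar measure `μ_P` on `P_Δ(𝔸)` and a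
`Γ_P = P_Δ(L⁺)`-covering weight `w₁` on `P_Δ(𝔸)` with `∫⁻ 𝟙{modDelta ≤ C₁} modDelta^τ w₁ dμ_P < ∞` for every `C₁`.  `n = 0`: `P_Δ(𝔸)` is
trivial.  `n ≥ 1`: ★ `godement_parabolic_integral` for the Siegel–Levi chart (★ `exists_siegelLeviChart`, ★ `exists_unipotentChart`,
★ `exists_compact_unipotent_cover`, ★ `exists_haar_conjBy_scaling`, ★ `mem_ratH_of_blk_eq_levi_map`) with `χ = modDelta`, `e = ½`,
`c₀ = n² [L:ℚ] < n [L:ℚ] · ½ · τ ⟺ τ > 2n`.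
[cite: Garrett2018, §3.10 (proof of Cor. 3.10.2)] [cite: MoeglinWaldspurger1995, II.1.5] -/
theorem parabolicIntegral (hdV0 : ∀ i, dV i ≠ 0) (hdW0 : ∀ i, dW i ≠ 0)
    [MeasurableSpace (HA L e dV hdV dW hdW)] [BorelSpace (HA L e dV hdV dW hdW)]
    (τ : ℝ) (hτ : 2 * (n : ℝ) < τ) :
    ∃ (μP : Measure (siegelDelta L e dV hdV dW hdW : Subgroup (HA L e dV hdV dW hdW))) (_ : μP.IsHaarMeasure)
      (w₁ : ↥(siegelDelta L e dV hdV dW hdW) → ℝ≥0∞),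
      IsCoveringWeight (↥((ratH L e dV hdV dW hdW).subgroupOf (siegelDelta L e dV hdV dW hdW))) w₁ ∧
      ∀ C₁ : ℝ, ∫⁻ p, {p : ↥(siegelDelta L e dV hdV dW hdW) |
          modDelta L e dV hdV dW hdW (p : HA L e dV hdV dW hdW) ≤ C₁}.indicator
            (fun p => ENNReal.ofReal (modDelta L e dV hdV dW hdW (p : HA L e dV hdV dW hdW) ^ τ)) p * w₁ p ∂μP ≠ ∞ := by
  classical
  have hτ0 : 0 ≤ τ := le_trans (by positivity) hτ.le
  -- instances on `P_Δ(𝔸)` and on `Γ_P`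
  haveI : T2Space (GL (Fin (n + n)) (AdeleRing (𝓞 L) L)) := t2Space_gl (n + n) L
  haveI : LocallyCompactSpace (siegelDelta L e dV hdV dW hdW : Subgroup (HA L e dV hdV dW hdW)) :=
    (isClosed_siegelDelta L e dV hdV dW hdW).locallyCompactSpace
  haveI : SecondCountableTopology (siegelDelta L e dV hdV dW hdW : Subgroup (HA L e dV hdV dW hdW)) :=
    TopologicalSpace.Subtype.secondCountableTopology _
  haveI : DiscreteTopology (ratH L e dV hdV dW hdW) :=
    discreteTopology_range_toAdelic (Fp L) L (IsCMField.complexConj L) (n + n) (hermD L e dV hdV dW hdW)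
  haveI : DiscreteTopology ((ratH L e dV hdV dW hdW).subgroupOf (siegelDelta L e dV hdV dW hdW)) := by
    refine DiscreteTopology.of_continuous_injective
      (f := fun x : ↥((ratH L e dV hdV dW hdW).subgroupOf (siegelDelta L e dV hdV dW hdW)) =>
        (⟨((x : (siegelDelta L e dV hdV dW hdW : Subgroup (HA L e dV hdV dW hdW))) : HA L e dV hdV dW hdW), Subgroup.mem_subgroupOf.1 x.2⟩ :
          ratH L e dV hdV dW hdW)) ?_ ?_
    · exact (continuous_subtype_val.comp continuous_subtype_val).subtype_mk _
    · intro x y hxy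
      have h := congrArg Subtype.val hxy
      dsimp only at h
      exact Subtype.ext (Subtype.ext h)
  haveI : Countable ((ratH L e dV hdV dW hdW).subgroupOf (siegelDelta L e dV hdV dW hdW)) := countable_ratSiegel L e dV hdV dW hdW
  rcases Nat.eq_zero_or_pos n with hn | hn
  · -- `n = 0`: `P_Δ(𝔸)` is a one-point group
    subst hn
    haveI : IsEmpty (Fin (0 + 0)) := Fin.isEmpty'
    haveI : Subsingleton (Matrix (Fin (0 + 0)) (Fin (0 + 0)) (AdeleRing (𝓞 L) L)) := inferInstanceAs (Subsingleton (Fin (0 + 0) → _))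
    haveI : Subsingleton (GL (Fin (0 + 0)) (AdeleRing (𝓞 L) L)) := ⟨fun a b => Units.ext (Subsingleton.elim _ _)⟩
    haveI : Subsingleton (siegelDelta L e dV hdV dW hdW : Subgroup (HA L e dV hdV dW hdW)) :=
      ⟨fun a b => Subtype.ext (Subtype.ext (Subsingleton.elim _ _))⟩
    haveI : CompactSpace (siegelDelta L e dV hdV dW hdW : Subgroup (HA L e dV hdV dW hdW)) := Finite.compactSpace
    obtain ⟨w, hw⟩ := exists_isCoveringWeight ((ratH L e dV hdV dW hdW).subgroupOf (siegelDelta L e dV hdV dW hdW))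
    refine ⟨haar, inferInstance, w, hw, fun C₁ => ?_⟩
    refine ne_top_of_le_ne_top (IsCompact.measure_lt_top (μ := (haar : Measure (siegelDelta L e dV hdV dW hdW :
      Subgroup (HA L e dV hdV dW hdW)))) isCompact_univ).ne ?_
    rw [← setLIntegral_univ]
    refine le_trans (lintegral_mono fun p => ?_) (le_of_eq (setLIntegral_one _))
    have hp : (p : HA L e dV hdV dW hdW) = 1 := Subsingleton.elim _ _
    calc {p : ↥(siegelDelta L e dV hdV dW hdW) | modDelta L e dV hdV dW hdW (p : HA L e dV hdV dW hdW) ≤ C₁}.indicator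
          (fun p => ENNReal.ofReal (modDelta L e dV hdV dW hdW (p : HA L e dV hdV dW hdW) ^ τ)) p * w p
        ≤ ENNReal.ofReal (modDelta L e dV hdV dW hdW (p : HA L e dV hdV dW hdW) ^ τ) * 1 :=
          mul_le_mul' (Set.indicator_le_self _ _ p) (hw.le_one p)
      _ = 1 := by rw [hp, modDelta_one', Real.one_rpow, ENNReal.ofReal_one, mul_one]
  · -- `n ≥ 1`: Godement's lemma for the Siegel–Levi chart
    obtain ⟨Mg, Ng, eMN, φ, hS, hNg, hNgD, hφ⟩ := exists_siegelLeviChart L e dV hdV dW hdW hdV0 hdW0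
    obtain ⟨υ, hυc, hυblk, hυadd, hυB, -⟩ := exists_unipotentChart L e dV hdV dW hdW hdV0 hdW0 hS φ hNg hNgD hφ
    obtain ⟨CN, hCNc, hCN⟩ := exists_compact_unipotent_cover L e dV hdV dW hdW hdV0 hdW0 υ hυc hυblk hυadd hυB
    obtain ⟨μN, hμN, hscale⟩ := exists_haar_conjBy_scaling L e dV hdV dW hdW hdV0 hdW0 hS φ hNg hNgD hφ
    haveI := hμN
    -- the measurable character `χ = modDelta` (through the continuous height ★ p854993)
    obtain ⟨Φ, hΦc, hΦpos, hΦ, -, -⟩ := exists_siegelHeight_continuous L e dV hdV dW hdW hdV0 hdW0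
    have hχm := measurable_modDelta_coe L e dV hdV dW hdW hΦc.measurable hΦpos hΦ
    -- hypotheses of Godement's lemma
    have hφΓ : ∀ γ ∈ rationalPointsGL n L, (((φ γ : ↥Mg) : (siegelDelta L e dV hdV dW hdW : Subgroup (HA L e dV hdV dW hdW))) ∈
        (ratH L e dV hdV dW hdW).subgroupOf (siegelDelta L e dV hdV dW hdW)) := by
      rintro _ ⟨γ₀, rfl⟩
      rw [Subgroup.mem_subgroupOf]
      exact mem_ratH_of_blk_eq_levi_map L e dV hdV dW hdW hdV0 hdW0 γ₀ (hφ _)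
    have hχN : ∀ (a : ↥Mg) (u : ↥Ng),
        modDelta L e dV hdV dW hdW (((a : (siegelDelta L e dV hdV dW hdW : Subgroup (HA L e dV hdV dW hdW))) * (u : (siegelDelta L e dV hdV dW hdW : Subgroup (HA L e dV hdV dW hdW))) : (siegelDelta L e dV hdV dW hdW : Subgroup (HA L e dV hdV dW hdW))) : HA L e dV hdV dW hdW) =
          modDelta L e dV hdV dW hdW ((a : (siegelDelta L e dV hdV dW hdW : Subgroup (HA L e dV hdV dW hdW))) : HA L e dV hdV dW hdW) := by
      intro a u
      have ha : IsSiegelDelta L e dV hdV dW hdW ((a : (siegelDelta L e dV hdV dW hdW : Subgroup (HA L e dV hdV dW hdW))) : HA L e dV hdV dW hdW) := (a : (siegelDelta L e dV hdV dW hdW : Subgroup (HA L e dV hdV dW hdW))).2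
      have hu : IsSiegelDelta L e dV hdV dW hdW ((u : (siegelDelta L e dV hdV dW hdW : Subgroup (HA L e dV hdV dW hdW))) : HA L e dV hdV dW hdW) := (u : (siegelDelta L e dV hdV dW hdW : Subgroup (HA L e dV hdV dW hdW))).2
      rw [Subgroup.coe_mul, modDelta_mul L e dV hdV dW hdW ha hu, modDelta_eq_one_of_blkA_eq_one L e dV hdV dW hdW hu ((hNg _).1 u.2), mul_one]
    have hχΓ : ∀ γ ∈ (ratH L e dV hdV dW hdW).subgroupOf (siegelDelta L e dV hdV dW hdW), ∀ b : (siegelDelta L e dV hdV dW hdW :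
        Subgroup (HA L e dV hdV dW hdW)), modDelta L e dV hdV dW hdW (((γ * b : (siegelDelta L e dV hdV dW hdW :
          Subgroup (HA L e dV hdV dW hdW))) : HA L e dV hdV dW hdW)) = modDelta L e dV hdV dW hdW (b : HA L e dV hdV dW hdW) := by
      intro γ hγ b
      rw [Subgroup.coe_mul]
      exact modDelta_rat_mul L e dV hdV dW hdW γ.2 (Subgroup.mem_subgroupOf.1 hγ) b.2
    have hχφ : ∀ g : GL (Fin n) (AdeleRing (𝓞 L) L), modDelta L e dV hdV dW hdW
        (((φ g : ↥Mg) : (siegelDelta L e dV hdV dW hdW : Subgroup (HA L e dV hdV dW hdW))) : HA L e dV hdV dW hdW) =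
        ((glAbsDet n L g : ℝ≥0) : ℝ) ^ (1 / 2 : ℝ) := fun g => modDelta_of_blk_eq_levi L e dV hdV dW hdW (hφ g)
    have hCN' : ∀ u : ↥Ng, ∃ γ : ↥Ng, ((γ : (siegelDelta L e dV hdV dW hdW : Subgroup (HA L e dV hdV dW hdW))) ∈
        (ratH L e dV hdV dW hdW).subgroupOf (siegelDelta L e dV hdV dW hdW)) ∧ γ⁻¹ * u ∈ CN := by
      intro u
      obtain ⟨γ, hγ, hc⟩ := hCN u
      exact ⟨γ, Subgroup.mem_subgroupOf.2 hγ, hc⟩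
    have hd : 0 < Module.finrank ℚ L := Module.finrank_pos
    have hconv : ((n * n * Module.finrank ℚ L : ℕ) : ℝ) < (n * Module.finrank ℚ L : ℕ) * (1 / 2 : ℝ) * τ := by
      have hn' : (0 : ℝ) < n := by exact_mod_cast hn
      have hd' : (0 : ℝ) < Module.finrank ℚ L := by exact_mod_cast hd
      push_cast
      nlinarith [mul_pos hn' hd']
    obtain ⟨μB, hμB, w, hw, hfin⟩ := godement_parabolic_integral hS ((ratH L e dV hdV dW hdW).subgroupOf (siegelDelta L e dV hdV dW hdW))
      L hn φ hφΓ hχm hχN hχΓ (eχ := 1 / 2) (by norm_num) hχφ hCNc hCN' μN hscale hτ0 hconv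
    exact ⟨μB, hμB, w, hw, hfin⟩

/-! ## §3 The socket -/

/-- **SOCKET #9 `sig_K2LiuSiegelEisensteinDoubledSummable` (type verbatim): ABSOLUTE CONVERGENCE OF THE SIEGEL EISENSTEIN SERIES of
`H = U(𝕍 ⊕ −𝕍)` on `Re s > n/2`** — for a unitary `χ`, a continuous Siegel section `f ∈ I(s, χ)` and `h ∈ H(𝔸)`,
`Σ_{γ ∈ P_Δ(L⁺)\H(L⁺)} |f(γ h)| < ∞`.  Proof: ★ (I) Iwasawa compactness `H(𝔸) = P_Δ(𝔸) K` + ★ (II) reduction to the height series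
`Σ Φ(γ h)^{-τ}` (`τ = 2 Re s + n`) + ★ (III-a) the continuous Plücker height + ★ Godement's count reduction + ★ parabolic reduction +
`parabolicIntegral` (E5′, `τ > 2n ⟺ Re s > n/2`).  [cite: Tan1999, §1] [cite: Liu2021, §B.3 p. 101]
[cite: Garrett2018, §3.10 Cor. 3.10.2] [cite: MoeglinWaldspurger1995, II.1.5] -/
theorem siegelEisensteinDoubledSummable :
    ∀ (L : Type) [Field L] [NumberField L] [IsCMField L] {N M n : ℕ} (e : Fin N × Fin M ≃ Fin n)
      (dV : Fin N → L) (hdV : ∀ i, IsCMField.complexConj L (dV i) = dV i) (_hdV0 : ∀ i, dV i ≠ 0)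
      (dW : Fin M → L) (hdW : ∀ i, IsCMField.complexConj L (dW i) = dW i) (_hdW0 : ∀ i, dW i ≠ 0)
      (χ : HeckeCharacter L), χ.IsUnitary →
        ∀ (s : ℂ), (n : ℝ) / 2 < s.re →
          ∀ f : HA L e dV hdV dW hdW → ℂ, IsSiegelDeltaSection L e dV hdV dW hdW χ s f → Continuous f →
            ∀ h : HA L e dV hdV dW hdW,
              Summable (fun q : SiegelDeltaQuot L e dV hdV dW hdW =>
                ‖f (((Quotient.out q : ratH L e dV hdV dW hdW) : HA L e dV hdV dW hdW) * h)‖) := by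
  intro L _ _ _ N M n e dV hdV hdV0 dW hdW hdW0 χ hχ s hs f hf hfc h
  -- Borel structure and a Haar measure on `H(𝔸)`
  letI : MeasurableSpace (HA L e dV hdV dW hdW) := borel _
  haveI : BorelSpace (HA L e dV hdV dW hdW) := ⟨rfl⟩
  let μ : Measure (HA L e dV hdV dW hdW) := Measure.haar
  -- the Iwasawa datum (★ socket «IWASAWA DATUM»)
  obtain ⟨𝒦⟩ := iwasawaDatumNonempty L e dV hdV hdV0 dW hdW hdW0
  -- the continuous height of record (★ #15a)
  obtain ⟨Φ, hΦc, hΦpos, hΦ, hΦK, hΦfloor⟩ := exists_siegelHeight_continuous L e dV hdV dW hdW hdV0 hdW0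
  have hΦm : Measurable Φ := hΦc.measurable
  obtain ⟨c, hc, hcK⟩ := hΦK _ 𝒦.isCompact_K
  have hτ : 2 * (n : ℝ) < 2 * s.re + (n : ℝ) := two_mul_lt_two_mul_re_add hs
  have hτ0 : 0 ≤ 2 * s.re + (n : ℝ) := (two_mul_re_add_pos (n := n) hs).le
  -- a `P_Δ(L⁺)`-weight on `H(𝔸)` and the parabolic integral
  obtain ⟨β', hβ'⟩ := exists_isCoveringWeight_siegelDeltaRat L e dV hdV dW hdW
  obtain ⟨μP, hμP, w₁, hw₁, hE5'⟩ := parabolicIntegral L e dV hdV dW hdW hdV0 hdW0 _ hτ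
  have hE5 := lintegral_siegelDomain_ne_top_of_parabolic L e dV hdV dW hdW μ 𝒦 hΦm hΦpos hΦ hΦK
    (upper_bound_of_floor L e dV hdV dW hdW hΦfloor) hτ0 μP hw₁ hE5' hβ'
  exact summable_norm_translate_of_iwasawa_of_height L e dV hdV dW hdW hχ hs hf hfc 𝒦.isCompact_K 𝒦.iwasawa hΦpos hΦ hc hcK h
    (summable_height_rpow_of_lintegral_ne_top L e dV hdV dW hdW μ 𝒦.isCompact_K 𝒦.iwasawa hΦm hΦpos hΦ hΦK hΦfloor
      hτ0 hβ' hE5 h)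

end Summit.HodgeConjecture.HodgeConjecture.Cruxes.HLiu418.K2LiuSiegelEisensteinDoubledSummable

end
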